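import Summits.KontsevichZagierPeriods.KontsevichZagierPeriods.Theorems.SymplecticScissorsRealOnePeriodRelationsStubRatCellsAux
import Summits.KontsevichZagierPeriods.KontsevichZagierPeriods.Theorems.SymplecticScissorsRealOnePeriodRelationsStubCells
import Literature.NumberTheory.Transcendental.KZSemiCanonicalReductionDimOne
import Mathlib.FieldTheory.AlgebraicClosure

/-!
# `RealOnePeriodRelations`, line `nash-retraction-thin-strip`, stub `stub_ratCells`

Stub `stub_ratCells` of the crux `RealOnePeriodRelations` (stmt-KontsevichZagierPeriods-10042, route
`SymplecticScissors`, reshape 3: the unconditional rational layer) — CELLS KEEP RATIONALITY: every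
element of the subgroup of `KZ.FormalRep` generated by the one-dimensional representations of
Kontsevich–Zagier's literal shape (`KZ.IntegralRep.IsRational`: integrand a quotient of polynomials
with rational coefficients on the domain) is, modulo `M₁ = closure (1a ∪ 1b ∪ 2 ∪ Green)`, a
`ℤ`-combination `Σ N(ρ) • [ρ]` of representations `ρ` on the unit interval `{z | z 0 ∈ (0,1)}` whose
integrand is on `(0,1)` a quotient `P/Q` of polynomials with real algebraic coefficients, `Q ≠ 0` on
`(0,1)`. The proof is the window induction of `stub_cells` with rationality in place of smoothness
(`RatCells.of_mem_cellSpanRat`, then `AddSubgroup.closure_le`), for one `r : IntegralRep 1` whose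
integrand is such a quotient on the whole domain (`RatCells.ratFns_of_isRational`):

* o-minimality of the line with rational coefficients
  (`GammaHodgeSectorNegative.exists_clopen_off_zeros`): off the real roots of a non-zero `q₁ ∈ ℚ[X]`
  the domain is open and closed, so every open interval avoiding these algebraic roots lies in the
  domain or misses it; rationality of the integrand being global on the domain, no second break-point
  polynomial is needed;
* the window induction `RatCells.of_mem_cellSpanRat_main` over the sorted break points inside an
  algebraic window `(a, b)`: split at a break point (rule 1a; slices are null), chart the full cells
  affinely onto `(0,1)` (rule 2 with algebraic coefficients: `RatCells.of_mem_cellSpanRat_Ioo`);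
* the two half lines `{0 < z 0}`, `{z 0 < 0}` are first pushed into the window `(0,1)` by the Möbius
  charts `t ↦ 1 − (1 + t)⁻¹`, `t ↦ (1 − t)⁻¹` (rule 2), whose inverses `u ↦ (1 − u)⁻¹ − 1`,
  `u ↦ 1 − u⁻¹` are rational, so that the pushed integrand `r.integrand (ψ u) / φ' (ψ u)` stays a
  quotient of polynomials (`RatCells.exists_push`).

References: M. Kontsevich, D. Zagier, *Periods* (2001), §1.1–§1.2; J. Bochnak, M. Coste, M.-F. Roy,
*Real Algebraic Geometry* (1998), §2.3.
-/

noncomputable section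
open scoped BigOperators Polynomial
open Set MeasureTheory Filter Topology
open scoped ContDiff
open Literature.NumberTheory.Transcendental Literature.ModelTheory.ExponentialFields
open Summit.KontsevichZagierPeriods.SymplecticScissors.RealOnePeriodRelationsNegative (M₁ H₁)

namespace Summit.KontsevichZagierPeriods.SymplecticScissors.RealOnePeriodRelations.RatCells

/-! ## The window induction -/

/-- A representation inside a slice `{z 0 = x}` has null domain, hence lies in `cellSpanRat`.
[cite: KontsevichZagier2001, §1.2 rule (1)] -/
theorem of_mem_cellSpanRat_of_subset_slice (r : KZ.IntegralRep 1) (x : ℝ)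
    (h : r.domain ⊆ {z | z 0 = x}) : KZ.of r ∈ cellSpanRat := by
  refine of_mem_cellSpanRat_of_null r (measure_mono_null h ?_)
  rw [show {z : Fin 1 → ℝ | z 0 = x} = Set.pi univ (fun _ => {x}) by ext z; simp [Fin.forall_fin_one],
    volume_pi_pi]
  simp

/-- A cell `{z | z 0 ∈ I}` inside `σ` has `I ⊆ line σ`. [folklore] -/
theorem subset_line_of {I : Set ℝ} {σ : Set (Fin 1 → ℝ)} (h : {z : Fin 1 → ℝ | z 0 ∈ I} ⊆ σ) :
    I ⊆ line σ :=
  fun t ht => h (show (fun _ : Fin 1 => t) ∈ {z : Fin 1 → ℝ | z 0 ∈ I} from ht)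

/-- **The window induction.** Let `L` be a strictly increasing list of algebraic numbers in the
algebraic window `(a, b)` and `r` a representation inside the window, with rational integrand, such
that every open subinterval of `[a, b]` avoiding `L` lies in the domain of `r` or misses it. Then
`[r] ∈ cellSpanRat`: split at the first break point (rule 1a), chart the left cell (rule 2), recurse on
the right. [cite: KontsevichZagier2001, §1.2] -/
theorem of_mem_cellSpanRat_main {b : ℝ} (hb : IsAlgebraic ℚ b) (L : List ℝ) :
    ∀ (a : ℝ) (r : KZ.IntegralRep 1), IsAlgebraic ℚ a → (∀ x ∈ L, IsAlgebraic ℚ x) →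
    L.Pairwise (· < ·) → (∀ x ∈ L, a < x ∧ x < b) → r.domain ⊆ {z | z 0 ∈ Ioo a b} →
    (∀ p q : ℝ, a ≤ p → q ≤ b → (∀ x ∈ L, x ∉ Ioo p q) →
      ({z : Fin 1 → ℝ | z 0 ∈ Ioo p q} ⊆ r.domain ∨ Disjoint {z : Fin 1 → ℝ | z 0 ∈ Ioo p q} r.domain)) →
    (fun t => r.integrand (fun _ => t)) ∈ ratFns (line r.domain) →
    KZ.of r ∈ cellSpanRat := by
  induction L with
  | nil =>
    intro a r ha _ _ _ hdom H1 hf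
    exact of_mem_cellSpanRat_window r ha hb hdom (H1 a b le_rfl le_rfl (by simp))
      fun hsub => RatFn.mono hf (subset_line_of hsub)
  | cons x L ih =>
    intro a r ha hLalg hsort hLab hdom H1 hf
    have hx : a < x ∧ x < b := hLab x (by simp)
    have hxalg : IsAlgebraic ℚ x := hLalg x (by simp)
    have hxL : ∀ y ∈ L, x < y := (List.pairwise_cons.mp hsort).1
    have havoid₁ : ∀ y ∈ x :: L, y ∉ Ioo a x := by
      intro y hy hy'
      rcases List.mem_cons.mp hy with rfl | hyL
      · exact lt_irrefl _ hy'.2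
      · exact lt_asymm (hxL y hyL) hy'.2
    refine of_mem_cellSpanRat_of_split_compl r {z | z 0 < x}
      (KZ.isSemialgebraic_setOf_apply_lt_const hxalg 0) ?_ ?_
    · -- left of `x`: a full or empty window `(a, x)`
      refine of_mem_cellSpanRat_window _ ha hxalg ?_ ?_ ?_
      · rintro z ⟨hz, hzx⟩
        exact ⟨(hdom hz).1, hzx⟩
      · rcases H1 a x le_rfl hx.2.le havoid₁ with h | h
        · exact Or.inl fun z hz => ⟨h hz, hz.2⟩
        · exact Or.inr (h.mono_right inter_subset_left)
      · intro hsub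
        exact RatFn.mono hf ((subset_line_of hsub).trans (line_mono inter_subset_left))
    · -- right of `x`, after removing the null slice `{z 0 = x}`
      set r' := r.restrict (r.domain ∩ {z | z 0 < x}ᶜ)
        (r.isSemialgebraic_domain.inter (KZ.isSemialgebraic_setOf_apply_lt_const hxalg 0).compl)
        inter_subset_left with hr'
      refine of_mem_cellSpanRat_of_split_compl r' {z | z 0 = x}
        (isSemialgebraic_setOf_apply_eq_of_isAlgebraic hxalg 0) ?_ ?_
      · exact of_mem_cellSpanRat_of_subset_slice _ x inter_subset_right
      · have hdom' : r'.domain ∩ {z : Fin 1 → ℝ | z 0 = x}ᶜ ⊆ {z | z 0 ∈ Ioo x b} := by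
          intro z hz
          simp only [hr', KZ.IntegralRep.domain_restrict, mem_inter_iff, mem_compl_iff, mem_setOf_eq,
            not_lt] at hz
          exact ⟨lt_of_le_of_ne hz.1.2 (Ne.symm hz.2), (hdom hz.1.1).2⟩
        have hsub' : ∀ p q : ℝ, x ≤ p → {z : Fin 1 → ℝ | z 0 ∈ Ioo p q} ⊆ r.domain →
            {z : Fin 1 → ℝ | z 0 ∈ Ioo p q} ⊆ r'.domain ∩ {z : Fin 1 → ℝ | z 0 = x}ᶜ := by
          intro p q hp h z hz
          have hxz : x < z 0 := lt_of_le_of_lt hp hz.1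
          exact ⟨⟨h hz, not_lt.mpr hxz.le⟩, ne_of_gt hxz⟩
        have havoid : ∀ p q : ℝ, x ≤ p → (∀ y ∈ L, y ∉ Ioo p q) → ∀ y ∈ x :: L, y ∉ Ioo p q := by
          intro p q hp hL y hy hy'
          rcases List.mem_cons.mp hy with rfl | hyL
          · exact not_le.mpr hy'.1 hp
          · exact hL y hyL hy'
        refine ih x _ hxalg (fun y hy => hLalg y (List.mem_cons_of_mem x hy))
          (List.pairwise_cons.mp hsort).2
          (fun y hy => ⟨hxL y hy, (hLab y (List.mem_cons_of_mem x hy)).2⟩) hdom' ?_ ?_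
        · intro p q hp hq hL
          rcases H1 p q (hx.1.le.trans hp) hq (havoid p q hp hL) with h | h
          · exact Or.inl (hsub' p q hp h)
          · exact Or.inr (h.mono_right (inter_subset_left.trans inter_subset_left))
        · exact RatFn.mono hf (line_mono (inter_subset_left.trans inter_subset_left))

/-- **Every representation with rational integrand inside an algebraic window is a combination of
rational unit cells.** The break points are the real roots of a non-zero rational polynomial `q₁`
off which the domain is open and closed (o-minimality of the line with rational coefficients); they
are algebraic, and between two consecutive ones the domain is full or empty (connectedness).
[cite: BochnakCosteRoy1998, §2.3] -/
theorem of_mem_cellSpanRat_of_subset_window (r : KZ.IntegralRep 1) {a b : ℝ} (ha : IsAlgebraic ℚ a)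
    (hb : IsAlgebraic ℚ b) (hdom : r.domain ⊆ {z | z 0 ∈ Ioo a b})
    (hf : (fun t => r.integrand (fun _ => t)) ∈ ratFns (line r.domain)) : KZ.of r ∈ cellSpanRat := by
  classical
  -- off the roots of `q₁` the domain is open and closed
  obtain ⟨q₁, hq₁, hopen, hopen'⟩ :=
    GammaHodgeSectorNegative.exists_clopen_off_zeros r.isSemialgebraic_domain
  -- the break points
  set F : Finset ℝ := (q₁.map (algebraMap ℚ ℝ)).roots.toFinset with hF
  have hmemF : ∀ x : ℝ, x ∈ F ↔ Polynomial.aeval x q₁ = 0 := by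
    intro x
    rw [hF, Multiset.mem_toFinset, Polynomial.mem_roots
      ((Polynomial.map_ne_zero_iff (algebraMap ℚ ℝ).injective).mpr hq₁), Polynomial.IsRoot.def,
      Polynomial.eval_map_algebraMap]
  have hFalg : ∀ x ∈ F, IsAlgebraic ℚ x := fun x hx => ⟨q₁, hq₁, (hmemF x).mp hx⟩
  set L : List ℝ := (F.filter fun x => a < x ∧ x < b).sort (· ≤ ·) with hL
  have hmemL : ∀ x, x ∈ L ↔ x ∈ F ∧ a < x ∧ x < b := fun x => by
    simp [hL, Finset.mem_sort, Finset.mem_filter]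
  have hsort : L.Pairwise (· < ·) := (Finset.sortedLT_sort _).pairwise
  have havoid : ∀ p q : ℝ, a ≤ p → q ≤ b → (∀ x ∈ L, x ∉ Ioo p q) → ∀ x ∈ F, x ∉ Ioo p q := by
    intro p q hp hq hLpq x hx hxpq
    exact hLpq x ((hmemL x).mpr ⟨hx, lt_of_le_of_lt hp hxpq.1, lt_of_lt_of_le hxpq.2 hq⟩) hxpq
  refine of_mem_cellSpanRat_main hb L a r ha (fun x hx => hFalg x ((hmemL x).mp hx).1) hsort
    (fun x hx => ((hmemL x).mp hx).2) hdom ?_ hf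
  -- an interval avoiding the break points lies in the domain or misses it
  intro p q hp hq' hLpq
  set C : Set (Fin 1 → ℝ) := {z | z 0 ∈ Ioo p q} with hC
  have hCU : C ⊆ {w : Fin 1 → ℝ | Polynomial.aeval (w 0) q₁ ≠ 0} := fun z hz h0 =>
    havoid p q hp hq' hLpq (z 0) ((hmemF _).mpr h0) hz
  have hCpre : IsPreconnected C := by
    have : C = (fun t : ℝ => (fun _ : Fin 1 => t)) '' Ioo p q := by
      ext z
      exact ⟨fun hz => ⟨z 0, hz, (KZ.eq_const_apply_zero z).symm⟩, fun ⟨t, ht, h⟩ => h ▸ ht⟩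
    rw [this]
    exact isPreconnected_Ioo.image _ (continuous_pi fun _ => continuous_id).continuousOn
  have hdisj : Disjoint (r.domain ∩ {w : Fin 1 → ℝ | Polynomial.aeval (w 0) q₁ ≠ 0})
      (r.domainᶜ ∩ {w : Fin 1 → ℝ | Polynomial.aeval (w 0) q₁ ≠ 0}) :=
    Set.disjoint_left.mpr fun z h₁ h₂ => h₂.1 h₁.1
  have hcover : C ⊆ (r.domain ∩ {w : Fin 1 → ℝ | Polynomial.aeval (w 0) q₁ ≠ 0}) ∪
      (r.domainᶜ ∩ {w : Fin 1 → ℝ | Polynomial.aeval (w 0) q₁ ≠ 0}) := by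
    intro z hz
    by_cases hzS : z ∈ r.domain
    · exact Or.inl ⟨hzS, hCU hz⟩
    · exact Or.inr ⟨hzS, hCU hz⟩
  rcases hCpre.subset_or_subset hopen hopen' hdisj hcover with h | h
  · exact Or.inl (h.trans inter_subset_left)
  · exact Or.inr (Set.disjoint_left.mpr fun z hz hzS => (h hz).1 hzS)

/-! ## From the line to a bounded window -/

/-- The right half line `{0 < z 0}` is pushed into the window `(0, 1)` by the chart `t ↦ 1 − (1 + t)⁻¹`
(rule 2), whose inverse `u ↦ (1 − u)⁻¹ − 1` is rational: rationality of the integrand is kept.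
[cite: KontsevichZagier2001, §1.2 rule (2)] -/
theorem of_mem_cellSpanRat_of_pos (r : KZ.IntegralRep 1) (hdom : r.domain ⊆ {z | 0 < z 0})
    (hf : (fun t => r.integrand (fun _ => t)) ∈ ratFns (line r.domain)) : KZ.of r ∈ cellSpanRat := by
  have hσ := r.isSemialgebraic_domain
  have hpos' : ∀ t ∈ line r.domain, 0 < 1 + t := fun t ht => by
    have h0 : 0 < t := hdom ht
    linarith
  have h1 : IsSemialgebraicFunOn ℚ r.domain (fun p => (1 + p 0)⁻¹) :=
    ((isSemialgebraicFunOn_const_ratCast hσ 1).fun_add (isSemialgebraicFunOn_apply hσ 0)).fun_inv.congr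
      fun p _ => by simp
  have hder : ∀ t ∈ line r.domain, HasDerivAt (fun t : ℝ => 1 - (1 + t)⁻¹) (((1 + t)⁻¹) ^ 2) t := by
    intro t ht
    refine ((((hasDerivAt_id' t).const_add 1).fun_inv (hpos' t ht).ne').const_sub 1).congr_deriv ?_
    rw [neg_div, neg_neg, one_div, inv_pow]
  have hpos : ∀ t ∈ line r.domain, 0 < ((1 + t)⁻¹) ^ 2 := fun t ht =>
    pow_pos (inv_pos.mpr (hpos' t ht)) 2
  have hψφ : ∀ t ∈ line r.domain, (1 - (1 - (1 + t)⁻¹))⁻¹ - 1 = t := fun t _ => by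
    rw [sub_sub_cancel, inv_inv, add_sub_cancel_left]
  have hφ'r : (fun t : ℝ => ((1 + t)⁻¹) ^ 2) ∈ ratFns (line r.domain) :=
    RatFn.pow (RatFn.inv (RatFn.add (RatFn.const _ isAlgebraic_one) (RatFn.id _))
      fun t ht => (hpos' t ht).ne') 2
  have hψr : (fun u : ℝ => (1 - u)⁻¹ - 1) ∈ ratFns ((fun t : ℝ => 1 - (1 + t)⁻¹) '' line r.domain) := by
    refine RatFn.sub (RatFn.inv (RatFn.sub (RatFn.const _ isAlgebraic_one) (RatFn.id _)) ?_)
      (RatFn.const _ isAlgebraic_one)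
    rintro _ ⟨t, ht, rfl⟩
    rw [sub_sub_cancel]
    exact (inv_pos.mpr (hpos' t ht)).ne'
  obtain ⟨s, hs, hsrat, hrel⟩ := exists_push r (fun t => 1 - (1 + t)⁻¹) (fun t => ((1 + t)⁻¹) ^ 2)
    (fun u => (1 - u)⁻¹ - 1)
    (((isSemialgebraicFunOn_const_ratCast hσ 1).fun_sub h1).congr fun p _ => by simp) (h1.fun_pow 2)
    hder hpos hψφ hf hφ'r hψr
  refine mem_cellSpanRat_of_sub_mem
    (of_mem_cellSpanRat_of_subset_window s isAlgebraic_zero isAlgebraic_one ?_ hsrat) hrel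
  intro z hz
  rw [mem_iff_line, hs] at hz
  obtain ⟨t, ht, htz⟩ := hz
  rw [mem_setOf_eq, ← htz]
  have h := hpos' t ht
  have h0 : 0 < t := hdom ht
  exact ⟨by simpa using inv_lt_one_of_one_lt₀ (by linarith), by simpa using h⟩

/-- The left half line `{z 0 < 0}` is pushed into the window `(0, 1)` by the chart `t ↦ (1 − t)⁻¹`
(rule 2), whose inverse `u ↦ 1 − u⁻¹` is rational: rationality of the integrand is kept.
[cite: KontsevichZagier2001, §1.2 rule (2)] -/
theorem of_mem_cellSpanRat_of_neg (r : KZ.IntegralRep 1) (hdom : r.domain ⊆ {z | z 0 < 0})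
    (hf : (fun t => r.integrand (fun _ => t)) ∈ ratFns (line r.domain)) : KZ.of r ∈ cellSpanRat := by
  have hσ := r.isSemialgebraic_domain
  have hpos' : ∀ t ∈ line r.domain, 0 < 1 - t := fun t ht => by
    have h0 : t < 0 := hdom ht
    linarith
  have h1 : IsSemialgebraicFunOn ℚ r.domain (fun p => (1 - p 0)⁻¹) :=
    ((isSemialgebraicFunOn_const_ratCast hσ 1).fun_sub (isSemialgebraicFunOn_apply hσ 0)).fun_inv.congr
      fun p _ => by simp
  have hder : ∀ t ∈ line r.domain, HasDerivAt (fun t : ℝ => (1 - t)⁻¹) (((1 - t)⁻¹) ^ 2) t := by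
    intro t ht
    refine (((hasDerivAt_id' t).const_sub 1).fun_inv (hpos' t ht).ne').congr_deriv ?_
    rw [neg_neg, one_div, inv_pow]
  have hpos : ∀ t ∈ line r.domain, 0 < ((1 - t)⁻¹) ^ 2 := fun t ht =>
    pow_pos (inv_pos.mpr (hpos' t ht)) 2
  have hψφ : ∀ t ∈ line r.domain, 1 - ((1 - t)⁻¹)⁻¹ = t := fun t _ => by
    rw [inv_inv, sub_sub_cancel]
  have hφ'r : (fun t : ℝ => ((1 - t)⁻¹) ^ 2) ∈ ratFns (line r.domain) :=
    RatFn.pow (RatFn.inv (RatFn.sub (RatFn.const _ isAlgebraic_one) (RatFn.id _))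
      fun t ht => (hpos' t ht).ne') 2
  have hψr : (fun u : ℝ => 1 - u⁻¹) ∈ ratFns ((fun t : ℝ => (1 - t)⁻¹) '' line r.domain) := by
    refine RatFn.sub (RatFn.const _ isAlgebraic_one) (RatFn.inv (RatFn.id _) ?_)
    rintro _ ⟨t, ht, rfl⟩
    exact (inv_pos.mpr (hpos' t ht)).ne'
  obtain ⟨s, hs, hsrat, hrel⟩ := exists_push r (fun t => (1 - t)⁻¹) (fun t => ((1 - t)⁻¹) ^ 2)
    (fun u => 1 - u⁻¹) h1 (h1.fun_pow 2) hder hpos hψφ hf hφ'r hψr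
  refine mem_cellSpanRat_of_sub_mem
    (of_mem_cellSpanRat_of_subset_window s isAlgebraic_zero isAlgebraic_one ?_ hsrat) hrel
  intro z hz
  rw [mem_iff_line, hs] at hz
  obtain ⟨t, ht, htz⟩ := hz
  rw [mem_setOf_eq, ← htz]
  have h := hpos' t ht
  have h0 : t < 0 := hdom ht
  exact ⟨by simpa using h, by simpa using inv_lt_one_of_one_lt₀ (by linarith)⟩

/-- **Every one-dimensional representation with rational integrand is a combination of rational unit
cells**: split at `0` (rule 1a; the slice `{z 0 = 0}` is null) and push the two half lines into the unit
window. [cite: KontsevichZagier2001, §1.2] -/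
theorem of_mem_cellSpanRat (r : KZ.IntegralRep 1)
    (hf : (fun t => r.integrand (fun _ => t)) ∈ ratFns (line r.domain)) : KZ.of r ∈ cellSpanRat := by
  refine of_mem_cellSpanRat_of_split_compl r {z | z 0 < 0} ?_
    (of_mem_cellSpanRat_of_neg _ inter_subset_right (RatFn.mono hf (line_mono inter_subset_left))) ?_
  · simpa using KZ.isSemialgebraic_setOf_apply_lt_const isAlgebraic_zero (0 : Fin 1)
  · set r' := r.restrict (r.domain ∩ {z : Fin 1 → ℝ | z 0 < 0}ᶜ) _ inter_subset_left with hr'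
    refine of_mem_cellSpanRat_of_split_compl r' {z | z 0 = 0} ?_
      (of_mem_cellSpanRat_of_subset_slice _ 0 inter_subset_right)
      (of_mem_cellSpanRat_of_pos _ ?_
        (RatFn.mono hf (line_mono (inter_subset_left.trans inter_subset_left))))
    · simpa using isSemialgebraic_setOf_apply_eq_of_isAlgebraic isAlgebraic_zero (0 : Fin 1)
    · intro z hz
      simp only [hr', KZ.IntegralRep.domain_restrict, mem_inter_iff, mem_compl_iff, mem_setOf_eq,
        not_lt] at hz
      exact lt_of_le_of_ne hz.1.2 (Ne.symm hz.2)

/-! ## Kontsevich–Zagier's literal shape -/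

/-- The real univariate polynomial with algebraic coefficients attached to `p ∈ ℚ[X₀]`. [folklore] -/
theorem aeval_map_aeval_X (p : MvPolynomial (Fin 1) ℚ) (t : ℝ) :
    Polynomial.aeval t ((MvPolynomial.aeval (fun _ : Fin 1 => (Polynomial.X : ℚ[X])) p).map
      (algebraMap ℚ (algebraicClosure ℚ ℝ))) = MvPolynomial.aeval (fun _ : Fin 1 => t) p := by
  rw [Polynomial.aeval_map_algebraMap, ← AlgHom.comp_apply, MvPolynomial.comp_aeval]
  simp

/-- The integrand of a representation of Kontsevich–Zagier's literal shape (a quotient of polynomials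
with rational coefficients on the domain) is a quotient of polynomials with real algebraic coefficients
on the domain read on `ℝ`. [cite: KontsevichZagier2001, §1.1] -/
theorem ratFns_of_isRational (r : KZ.IntegralRep 1) (hr : r.IsRational) :
    (fun t => r.integrand (fun _ => t)) ∈ ratFns (line r.domain) := by
  obtain ⟨p, q, hq, hpq⟩ := hr
  refine ⟨(MvPolynomial.aeval (fun _ : Fin 1 => (Polynomial.X : ℚ[X])) p).map
      (algebraMap ℚ (algebraicClosure ℚ ℝ)),
    (MvPolynomial.aeval (fun _ : Fin 1 => (Polynomial.X : ℚ[X])) q).map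
      (algebraMap ℚ (algebraicClosure ℚ ℝ)), fun t ht => ?_, fun t ht => ?_⟩
  · rw [aeval_map_aeval_X]
    exact hq _ ht
  · rw [aeval_map_aeval_X, aeval_map_aeval_X]
    exact hpq ht

end Summit.KontsevichZagierPeriods.SymplecticScissors.RealOnePeriodRelations.RatCells

namespace Summit.KontsevichZagierPeriods.SymplecticScissors.RealOnePeriodRelations.RationalLayer

/-- **Stub `stub_ratCells`** (line `nash-retraction-thin-strip`, rational layer) — CELLS KEEP
RATIONALITY.  Every element of the subgroup generated by the one-dimensional representations of
Kontsevich–Zagier's literal shape is, modulo `M₁`, a `ℤ`-combination of representations on the unit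
interval whose integrand is, on `(0,1)`, a quotient of polynomials with real algebraic coefficients whose
denominator does not vanish on `(0,1)` (`RatCells.of_mem_cellSpanRat` for the generators,
`AddSubgroup.closure_le` for the subgroup). [cite: KontsevichZagier2001, §1.2] [cite: BochnakCosteRoy1998, §2.3] -/
theorem stub_ratCells : ∀ c : KZ.FormalRep,
    c ∈ AddSubgroup.closure ((fun r : KZ.IntegralRep 1 => KZ.of r) '' {r | r.IsRational}) →
    ∃ N : KZ.IntegralRep 1 →₀ ℤ,
      (∀ ρ ∈ N.support, ρ.domain = {z | z 0 ∈ Set.Ioo (0 : ℝ) 1} ∧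
        ∃ P Q : Polynomial (algebraicClosure ℚ ℝ),
          (∀ t ∈ Set.Ioo (0 : ℝ) 1, Polynomial.aeval t Q ≠ 0) ∧
          ∀ t ∈ Set.Ioo (0 : ℝ) 1, ρ.integrand (fun _ => t) = Polynomial.aeval t P / Polynomial.aeval t Q) ∧
      c - N.sum (fun ρ m => m • KZ.of ρ) ∈ M₁ := by
  intro c hc
  have h : AddSubgroup.closure ((fun r : KZ.IntegralRep 1 => KZ.of r) '' {r | r.IsRational}) ≤
      RatCells.cellSpanRat :=
    (AddSubgroup.closure_le _).mpr (by
      rintro _ ⟨r, hr, rfl⟩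
      exact RatCells.of_mem_cellSpanRat r (RatCells.ratFns_of_isRational r hr))
  obtain ⟨N, hN, hcN⟩ := h hc
  exact ⟨N, hN, hcN⟩

end Summit.KontsevichZagierPeriods.SymplecticScissors.RealOnePeriodRelations.RationalLayer

end
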